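import Summits.Ventures.HodgeRepro.Tier3KunnethDiagonal
import Summits.Ventures.HodgeRepro.Tier3ProjectorCommutes

/-!
# The Künneth component is a module over `R = F^{⊗2p}` — §3's «`K` is a module over the `ℚ`-algebra `R`» on the kernel

Blind re-derivation cell `pub-hodge-repro`, seat `t3-p4` (Tier 3, T3.5 for T3.4 = Lemma R).  Target tree path
`lean/Summits/Ventures/HodgeRepro/Tier3KunnethTensorAction.lean`; imports the cell's `Tier3KunnethDiagonal` (the
multilinear laws of the diagonal operators on the Künneth component, `diag_map_ιMulti_kunneth`) and
`Tier3ProjectorCommutes` (transitively `Tier3ProjectorCorrespondence.diag_comp_diag`).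

WHAT THIS FILE STATES (LEMMA-R-RESIDUE.md §3, last sentence: «Hence `K` is a module over the `ℚ`-algebra
`R := F^{⊗ 2p} = F ⊗_ℚ ⋯ ⊗_ℚ F` (`a_1 ⊗ ⋯ ⊗ a_{2p} ↦ ⊗_i ι_i(a_i)^*`), and EVERY element of `R` acts on `K` by a
`ℚ`-linear combination of pull-backs along endomorphisms of `B`»).  On the kernel `V = H¹(B, ℚ)` is a `K`-space with
`K`-basis `ω′ : ι → V` (one generator per corner; `K = F`, `F₀ = ℚ`, `n = 2p`), the product endomorphism
`α(a_1, …, a_{2p})^*` is the diagonal operator `⋀ⁿ(A′ b)`, `A′ b = (ω′ᵢ ↦ bᵢ • ω′ᵢ)`, `b : ι → K`, the Künneth component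
`K_{Künneth} ⊂ ⋀[F₀]^n V` is the `F₀`-span of the wedges with exactly one vector from each corner (stated without a
definition, as in `Tier3WeilLineKunneth`), and `R` is Mathlib's `⨂[F₀] _ : ι, K` (`PiTensorProduct`, an `F₀`-algebra).
`Tier3KunnethDiagonal` stated the multilinear law in `b` of `b ↦ ⋀ⁿ(A′ b)|_{K_{Künneth}}` and said in so many words that
«the `R`-module structure itself (`R = K^{⊗_{F₀} n}` acting through its universal property) is not built».  This file
builds it — WITHOUT a definition — as an existence-and-uniqueness statement:

* `diag_map_mem_kunneth` — the Künneth component is stable under every diagonal operator (`⋀ⁿ(A′ b)` sends a Künneth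
  wedge `∧_t c_t ω′_{e t}` to the Künneth wedge `∧_t (b (e t) c_t) ω′_{e t}`);
* `constr_one_eq_id` / `map_diag_one` — `A′ 1 = id`, `⋀ⁿ(A′ 1) = id`;
* `existsUnique_algHom_tprod_eq_map_diag` — **§3's «`K` is a module over the `ℚ`-algebra `R`»**: there is EXACTLY ONE
  `F₀`-algebra homomorphism `ρ : ⨂[F₀] _ : ι, K →ₐ[F₀] End_{F₀}(K_{Künneth})` with `ρ (a_1 ⊗ ⋯ ⊗ a_n) = ⋀ⁿ(A′ a)|_{K_{Künneth}}`
  on every pure tensor — a module structure of `K_{Künneth}` over `R` is the same thing as such an algebra homomorphism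
  (`PiTensorProduct.liftAlgHom` on the multilinear map of `Tier3KunnethDiagonal`; `⋀ⁿ(A′ 1) = id` and
  `⋀ⁿ(A′ (b b′)) = ⋀ⁿ(A′ b) ∘ ⋀ⁿ(A′ b′)` make it multiplicative; uniqueness by `PiTensorProduct.ext`);
* `algHom_mem_span_range_restrict_map_diag` / `exists_eq_sum_smul_map_diag_of_algHom_tprod` — **«EVERY element of `R`
  acts on `K` by a `ℚ`-linear combination of pull-backs along endomorphisms of `B`»**: for every `r ∈ R`, `ρ r` lies in
  the `F₀`-span of the restricted diagonal operators, i.e. `ρ r = Σ_m q_m • ⋀ⁿ(A′ b_m)|_{K_{Künneth}}` with `q_m ∈ F₀`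
  (the pure tensors span `R`: `PiTensorProduct.induction_on`);
* `algHom_tprod_ιMulti_kunneth` — «`a_1 ⊗ ⋯ ⊗ a_{2p}` acts as `⊗_i ι_i(a_i)^*`»: on a Künneth wedge the pure tensor
  scales the slot of each corner by its coordinate;
* `algHom_singleAlgHom_eq_act` — §4(d)'s `act(a) = α(a, 1, …, 1)^*` is the action of the pure tensor `1 ⊗ ⋯ ⊗ a ⊗ ⋯ ⊗ 1`
  (`PiTensorProduct.singleAlgHom`);
* `algHom_mul_comm` — «`R` commutative»: the operators `ρ r`, `r ∈ R`, commute pairwise (so every `ρ r`, in particular the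
  orbit projector `e ∈ R` of §4(c), commutes with every `ρ r′` — §4(d)'s parenthetical at the level of `R`;
  `Tier3ProjectorCommutes` has it for the diagonal operators themselves).

HONESTY.  A LABEL for §3's sentence: `Tier3KunnethDiagonal` already carried the multilinear law that determines the
action, `Tier3ProjectorCorrespondence` the composition law; this file only assembles them into the algebra homomorphism
the sentence names, through Mathlib's universal property of the tensor product, and records that the pure tensors span.
No consumer of the lane needs the homomorphism (Lemma R uses the operators `⋀ⁿ(A′ b)` directly); the `R`-module law
is stated as an existence-and-uniqueness theorem, never as a definition or instance (the no-definition rule of the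
cell).  Linear algebra on the cell's own modules and Mathlib; no definition, instance or notation is introduced;
nothing geometric is built.  Nothing mathematical moves (LEMMA-R-RESIDUE: residue 0 unchanged).  HC_CM is NOT proved by
anyone in this repository.
-/

set_option autoImplicit false

open TensorProduct Finset

namespace HodgeRepro.Tier3

open HodgeRepro.RouteC

/-! ### §1 The Künneth component is stable under the diagonal operators; `A′ 1 = id` -/

section Stability

variable {F₀ K : Type*} [Field F₀] [Field K] [Algebra F₀ K]
variable {V : Type*} [AddCommGroup V] [Module K V] [Module F₀ V] [IsScalarTower F₀ K V]
variable {ι : Type*}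

/-- **The Künneth component is stable under every diagonal operator**: `⋀ⁿ(A′ b)` sends the Künneth wedge
`∧_t c_t ω′_{e t}` to the Künneth wedge `∧_t (b (e t) · c_t) ω′_{e t}` (`diag_map_ιMulti_kunneth`), so it maps the
`F₀`-span of the Künneth wedges into itself — §3's «acts on `K`». -/
theorem diag_map_mem_kunneth (n : ℕ) (ω' : Module.Basis ι K V) (b : ι → K) (w : ⋀[F₀]^n V)
    (hw : w ∈ Submodule.span F₀ {w : ⋀[F₀]^n V | ∃ (c : Fin n → K) (e : Fin n → ι), Function.Bijective e ∧
      w = exteriorPower.ιMulti F₀ n (fun t => c t • ω' (e t))}) :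
    exteriorPower.map n ((ω'.constr K fun i => b i • ω' i).restrictScalars F₀) w ∈
      Submodule.span F₀ {w : ⋀[F₀]^n V | ∃ (c : Fin n → K) (e : Fin n → ι), Function.Bijective e ∧
        w = exteriorPower.ιMulti F₀ n (fun t => c t • ω' (e t))} := by
  have hle : (Submodule.span F₀ {w : ⋀[F₀]^n V | ∃ (c : Fin n → K) (e : Fin n → ι), Function.Bijective e ∧
      w = exteriorPower.ιMulti F₀ n (fun t => c t • ω' (e t))}).map
        (exteriorPower.map n ((ω'.constr K fun i => b i • ω' i).restrictScalars F₀)) ≤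
      Submodule.span F₀ {w : ⋀[F₀]^n V | ∃ (c : Fin n → K) (e : Fin n → ι), Function.Bijective e ∧
        w = exteriorPower.ιMulti F₀ n (fun t => c t • ω' (e t))} := by
    rw [Submodule.map_span_le]
    rintro _ ⟨c, e, hbij, rfl⟩
    rw [diag_map_ιMulti_kunneth]
    exact Submodule.subset_span ⟨fun t => b (e t) * c t, e, hbij, rfl⟩
  exact hle (Submodule.mem_map_of_mem hw)

/-- **`A′ 1 = id`**: the diagonal operator of the constant family `1 : ι → K` is the identity of `V`
(`ω′ᵢ ↦ 1 • ω′ᵢ`). -/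
theorem constr_one_eq_id (ω' : Module.Basis ι K V) :
    (ω'.constr K fun i => (1 : ι → K) i • ω' i) = LinearMap.id := by
  refine ω'.ext fun i => ?_
  rw [Module.Basis.constr_basis, LinearMap.id_apply, Pi.one_apply, one_smul]

/-- **`⋀ⁿ(A′ 1) = id`** on the wedge space (`exteriorPower.map_id`). -/
theorem map_diag_one (n : ℕ) (ω' : Module.Basis ι K V) :
    exteriorPower.map n ((ω'.constr K fun i => (1 : ι → K) i • ω' i).restrictScalars F₀) = LinearMap.id := by
  rw [constr_one_eq_id, LinearMap.restrictScalars_id, exteriorPower.map_id]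

end Stability

/-! ### §2 The algebra homomorphism `R = ⨂[F₀] _ : ι, K → End_{F₀}(K_{Künneth})` — §3's «`K` is a module over `R`» -/

section TensorAction

variable {F₀ K : Type*} [Field F₀] [Field K] [Algebra F₀ K]
variable {V : Type*} [AddCommGroup V] [Module K V] [Module F₀ V] [IsScalarTower F₀ K V]
variable {ι : Type*}

/-- **§3's «`K` is a module over the `ℚ`-algebra `R := F^{⊗2p}` (`a_1 ⊗ ⋯ ⊗ a_{2p} ↦ ⊗_i ι_i(a_i)^*`)»**: there is
EXACTLY ONE `F₀`-algebra homomorphism `ρ` from `R = ⨂[F₀] _ : ι, K` to the `F₀`-endomorphisms of the Künneth component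
whose value on every pure tensor `a_1 ⊗ ⋯ ⊗ a_n` is the restricted diagonal operator `⋀ⁿ(A′ a)|_{K_{Künneth}}` — the
module structure the sentence names.  Existence: `b ↦ ⋀ⁿ(A′ b)|_{K_{Künneth}}` is `F₀`-multilinear in `b`
(`Tier3KunnethDiagonal`), sends `1` to `id` (`map_diag_one`) and products to composites (`diag_comp_diag`,
`exteriorPower.map_comp`), so `PiTensorProduct.liftAlgHom` lifts it; uniqueness: an `F₀`-linear map out of `R` is
determined by its values on the pure tensors (`PiTensorProduct.ext`). -/
theorem existsUnique_algHom_tprod_eq_map_diag (n : ℕ) (ω' : Module.Basis ι K V) :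
    ∃! ρ : (⨂[F₀] _ : ι, K) →ₐ[F₀] Module.End F₀ (Submodule.span F₀ {w : ⋀[F₀]^n V |
        ∃ (c : Fin n → K) (e : Fin n → ι), Function.Bijective e ∧
          w = exteriorPower.ιMulti F₀ n (fun t => c t • ω' (e t))}),
      ∀ (b : ι → K) (w : Submodule.span F₀ {w : ⋀[F₀]^n V | ∃ (c : Fin n → K) (e : Fin n → ι),
          Function.Bijective e ∧ w = exteriorPower.ιMulti F₀ n (fun t => c t • ω' (e t))}),
        ((ρ (PiTensorProduct.tprod F₀ b)) w : ⋀[F₀]^n V) =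
          exteriorPower.map n ((ω'.constr K fun i => b i • ω' i).restrictScalars F₀) w := by
  set Kün : Submodule F₀ (⋀[F₀]^n V) := Submodule.span F₀ {w : ⋀[F₀]^n V | ∃ (c : Fin n → K) (e : Fin n → ι),
    Function.Bijective e ∧ w = exteriorPower.ιMulti F₀ n (fun t => c t • ω' (e t))} with hKün
  let D : (ι → K) → Module.End F₀ Kün := fun b =>
    (exteriorPower.map n ((ω'.constr K fun i => b i • ω' i).restrictScalars F₀)).restrict
      (diag_map_mem_kunneth n ω' b)
  have hD : ∀ (b : ι → K) (w : Kün), ((D b w : Kün) : ⋀[F₀]^n V) =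
      exteriorPower.map n ((ω'.constr K fun i => b i • ω' i).restrictScalars F₀) w := fun b w =>
    LinearMap.coe_restrict_apply _ _
  let f : MultilinearMap F₀ (fun _ : ι => K) (Module.End F₀ Kün) :=
    { toFun := D
      map_update_add' := by
        intro _ b i a a'
        refine LinearMap.ext fun w => Subtype.ext ?_
        rw [LinearMap.add_apply, Submodule.coe_add, hD, hD, hD]
        exact diag_map_update_add_of_mem_kunneth n ω' b i a a' (w : ⋀[F₀]^n V)
          ((Submodule.ext_iff.mp hKün (w : ⋀[F₀]^n V)).mp w.2)
      map_update_smul' := by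
        intro _ b i r a
        refine LinearMap.ext fun w => Subtype.ext ?_
        rw [LinearMap.smul_apply, Submodule.coe_smul, hD, hD]
        exact diag_map_update_smul_of_mem_kunneth n ω' b i r a (w : ⋀[F₀]^n V)
          ((Submodule.ext_iff.mp hKün (w : ⋀[F₀]^n V)).mp w.2) }
  have hone : f 1 = 1 := by
    refine LinearMap.ext fun w => Subtype.ext ?_
    show ((D 1 w : Kün) : ⋀[F₀]^n V) = ((1 : Module.End F₀ Kün) w : Kün)
    rw [hD, map_diag_one, LinearMap.id_apply, Module.End.one_apply]
  have hmul : ∀ b b' : ι → K, f (b * b') = f b * f b' := by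
    intro b b'
    refine LinearMap.ext fun w => Subtype.ext ?_
    show ((D (b * b') w : Kün) : ⋀[F₀]^n V) = ((D b * D b') w : Kün)
    rw [Module.End.mul_apply, hD, hD, hD, ← diag_comp_diag, exteriorPower.map_comp, LinearMap.comp_apply]
  refine ⟨PiTensorProduct.liftAlgHom f hone hmul, fun b w => ?_, fun ρ hρ => ?_⟩
  · show ((PiTensorProduct.lift f (PiTensorProduct.tprod F₀ b)) w : ⋀[F₀]^n V) = _
    rw [PiTensorProduct.lift.tprod]
    exact hD b w
  · apply AlgHom.toLinearMap_injective
    apply PiTensorProduct.ext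
    refine MultilinearMap.ext fun b => ?_
    refine LinearMap.ext fun w => Subtype.ext ?_
    simp only [LinearMap.compMultilinearMap_apply, AlgHom.toLinearMap_apply]
    rw [hρ b w]
    show _ = ((PiTensorProduct.lift f (PiTensorProduct.tprod F₀ b)) w : ⋀[F₀]^n V)
    rw [PiTensorProduct.lift.tprod]
    exact (hD b w).symm

/-- **«EVERY element of `R` acts on `K` by a `ℚ`-linear combination of pull-backs along endomorphisms of `B`»** — span
form: for an algebra homomorphism `ρ` as in `existsUnique_algHom_tprod_eq_map_diag` and every `r ∈ R`, `ρ r` lies in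
the `F₀`-span of the restricted diagonal operators `⋀ⁿ(A′ b)|_{K_{Künneth}}` (the pure tensors span `R`:
`PiTensorProduct.induction_on`). -/
theorem algHom_mem_span_range_restrict_map_diag (n : ℕ) (ω' : Module.Basis ι K V)
    (ρ : (⨂[F₀] _ : ι, K) →ₐ[F₀] Module.End F₀ (Submodule.span F₀ {w : ⋀[F₀]^n V |
        ∃ (c : Fin n → K) (e : Fin n → ι), Function.Bijective e ∧
          w = exteriorPower.ιMulti F₀ n (fun t => c t • ω' (e t))}))
    (hρ : ∀ (b : ι → K) (w : Submodule.span F₀ {w : ⋀[F₀]^n V | ∃ (c : Fin n → K) (e : Fin n → ι),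
          Function.Bijective e ∧ w = exteriorPower.ιMulti F₀ n (fun t => c t • ω' (e t))}),
        ((ρ (PiTensorProduct.tprod F₀ b)) w : ⋀[F₀]^n V) =
          exteriorPower.map n ((ω'.constr K fun i => b i • ω' i).restrictScalars F₀) w)
    (r : ⨂[F₀] _ : ι, K) :
    ρ r ∈ Submodule.span F₀ (Set.range fun b : ι → K =>
      (exteriorPower.map n ((ω'.constr K fun i => b i • ω' i).restrictScalars F₀)).restrict
        (diag_map_mem_kunneth n ω' b)) := by
  induction r using PiTensorProduct.induction_on with
  | smul_tprod c b =>
    rw [map_smul]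
    refine Submodule.smul_mem _ c (Submodule.subset_span ⟨b, ?_⟩)
    refine LinearMap.ext fun w => Subtype.ext ?_
    rw [LinearMap.coe_restrict_apply, hρ]
  | add x y hx hy =>
    rw [map_add]
    exact Submodule.add_mem _ hx hy

/-- The same in the lane's explicit form (`Tier3ProjectorCorrespondence.exists_eq_sum_smul_map_diag`): for every
`r ∈ R` there are `N`, `q : Fin N → F₀` and `b : Fin N → (ι → K)` with `ρ r = Σ_m q_m • ⋀ⁿ(A′ b_m)` on the Künneth
component. -/
theorem exists_eq_sum_smul_map_diag_of_algHom_tprod (n : ℕ) (ω' : Module.Basis ι K V)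
    (ρ : (⨂[F₀] _ : ι, K) →ₐ[F₀] Module.End F₀ (Submodule.span F₀ {w : ⋀[F₀]^n V |
        ∃ (c : Fin n → K) (e : Fin n → ι), Function.Bijective e ∧
          w = exteriorPower.ιMulti F₀ n (fun t => c t • ω' (e t))}))
    (hρ : ∀ (b : ι → K) (w : Submodule.span F₀ {w : ⋀[F₀]^n V | ∃ (c : Fin n → K) (e : Fin n → ι),
          Function.Bijective e ∧ w = exteriorPower.ιMulti F₀ n (fun t => c t • ω' (e t))}),
        ((ρ (PiTensorProduct.tprod F₀ b)) w : ⋀[F₀]^n V) =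
          exteriorPower.map n ((ω'.constr K fun i => b i • ω' i).restrictScalars F₀) w)
    (r : ⨂[F₀] _ : ι, K) :
    ∃ (N : ℕ) (q : Fin N → F₀) (b : Fin N → (ι → K)),
      ∀ w : Submodule.span F₀ {w : ⋀[F₀]^n V | ∃ (c : Fin n → K) (e : Fin n → ι),
          Function.Bijective e ∧ w = exteriorPower.ιMulti F₀ n (fun t => c t • ω' (e t))},
        ((ρ r) w : ⋀[F₀]^n V) =
          ∑ m, q m • exteriorPower.map n ((ω'.constr K fun i => b m i • ω' i).restrictScalars F₀) w := by
  obtain ⟨N, q, g, hg⟩ :=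
    Submodule.mem_span_set'.mp (algHom_mem_span_range_restrict_map_diag n ω' ρ hρ r)
  choose b hb using fun m => Set.mem_range.mp (g m).2
  refine ⟨N, q, b, fun w => ?_⟩
  rw [← hg, LinearMap.sum_apply, Submodule.coe_sum]
  refine Finset.sum_congr rfl fun m _ => ?_
  rw [LinearMap.smul_apply, Submodule.coe_smul, ← hb m, LinearMap.coe_restrict_apply]

/-- **«`a_1 ⊗ ⋯ ⊗ a_{2p}` acts as `⊗_i ι_i(a_i)^*`»**: on the Künneth wedge `∧_t c_t ω′_{e t}` (`e` a bijective
enumeration of the corners) the pure tensor `b` acts by scaling the slot of each corner by its coordinate,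
`∧_t (b (e t) · c_t) ω′_{e t}`. -/
theorem algHom_tprod_ιMulti_kunneth (n : ℕ) (ω' : Module.Basis ι K V)
    (ρ : (⨂[F₀] _ : ι, K) →ₐ[F₀] Module.End F₀ (Submodule.span F₀ {w : ⋀[F₀]^n V |
        ∃ (c : Fin n → K) (e : Fin n → ι), Function.Bijective e ∧
          w = exteriorPower.ιMulti F₀ n (fun t => c t • ω' (e t))}))
    (hρ : ∀ (b : ι → K) (w : Submodule.span F₀ {w : ⋀[F₀]^n V | ∃ (c : Fin n → K) (e : Fin n → ι),
          Function.Bijective e ∧ w = exteriorPower.ιMulti F₀ n (fun t => c t • ω' (e t))}),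
        ((ρ (PiTensorProduct.tprod F₀ b)) w : ⋀[F₀]^n V) =
          exteriorPower.map n ((ω'.constr K fun i => b i • ω' i).restrictScalars F₀) w)
    (b : ι → K) (c : Fin n → K) (e : Fin n → ι) (he : Function.Bijective e) :
    ((ρ (PiTensorProduct.tprod F₀ b))
        ⟨exteriorPower.ιMulti F₀ n (fun t => c t • ω' (e t)), Submodule.subset_span ⟨c, e, he, rfl⟩⟩ :
          ⋀[F₀]^n V) =
      exteriorPower.ιMulti F₀ n (fun t => (b (e t) * c t) • ω' (e t)) := by
  rw [hρ]
  exact diag_map_ιMulti_kunneth n ω' b c e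

/-- **§4(d)'s `act(a) := α(a, 1, …, 1)^*` is the action of the pure tensor `1 ⊗ ⋯ ⊗ a ⊗ ⋯ ⊗ 1`**
(`PiTensorProduct.singleAlgHom i₀ a`): on the Künneth component it is `⋀ⁿ(A′ (a at i₀, 1 elsewhere))`. -/
theorem algHom_singleAlgHom_eq_act [DecidableEq ι] (n : ℕ) (ω' : Module.Basis ι K V)
    (ρ : (⨂[F₀] _ : ι, K) →ₐ[F₀] Module.End F₀ (Submodule.span F₀ {w : ⋀[F₀]^n V |
        ∃ (c : Fin n → K) (e : Fin n → ι), Function.Bijective e ∧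
          w = exteriorPower.ιMulti F₀ n (fun t => c t • ω' (e t))}))
    (hρ : ∀ (b : ι → K) (w : Submodule.span F₀ {w : ⋀[F₀]^n V | ∃ (c : Fin n → K) (e : Fin n → ι),
          Function.Bijective e ∧ w = exteriorPower.ιMulti F₀ n (fun t => c t • ω' (e t))}),
        ((ρ (PiTensorProduct.tprod F₀ b)) w : ⋀[F₀]^n V) =
          exteriorPower.map n ((ω'.constr K fun i => b i • ω' i).restrictScalars F₀) w)
    (i₀ : ι) (a : K)
    (w : Submodule.span F₀ {w : ⋀[F₀]^n V | ∃ (c : Fin n → K) (e : Fin n → ι),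
          Function.Bijective e ∧ w = exteriorPower.ιMulti F₀ n (fun t => c t • ω' (e t))}) :
    ((ρ (PiTensorProduct.singleAlgHom i₀ a)) w : ⋀[F₀]^n V) =
      exteriorPower.map n
        ((ω'.constr K fun i => Function.update (fun _ => (1 : K)) i₀ a i • ω' i).restrictScalars F₀) w := by
  rw [PiTensorProduct.singleAlgHom_apply, hρ]
  rfl

omit [IsScalarTower F₀ K V] in
/-- **«`R` commutative»**: the operators `ρ r`, `r ∈ R`, commute pairwise — in particular every `ρ r` (the orbit
projector `e ∈ R` of §4(c) among them) commutes with every `ρ r′`, §4(d)'s parenthetical «`e` commutes with `R`,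
`R` commutative» at the level of `R` (`Tier3ProjectorCommutes` has it for the diagonal operators themselves). -/
theorem algHom_mul_comm (n : ℕ) (ω' : Module.Basis ι K V)
    (ρ : (⨂[F₀] _ : ι, K) →ₐ[F₀] Module.End F₀ (Submodule.span F₀ {w : ⋀[F₀]^n V |
        ∃ (c : Fin n → K) (e : Fin n → ι), Function.Bijective e ∧
          w = exteriorPower.ιMulti F₀ n (fun t => c t • ω' (e t))}))
    (r r' : ⨂[F₀] _ : ι, K) :
    ρ r * ρ r' = ρ r' * ρ r := by
  rw [← map_mul, ← map_mul, mul_comm]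

end TensorAction

end HodgeRepro.Tier3
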